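import Summits.ValiantsHypothesis.ValiantsHypothesis.Theorems.BinomialCandidate.Negative.IntegralDeepSmallLevels

/-!
# `stub_integralDeep` fails at level `7` — the v7 skeleton text (two pole directions at infinity)

Companion of `Negative/IntegralDeepSmallLevels.lean` (p173768; refuter crux-attack (a), 2026-08-17).  At 19:03Z the lead (c3)
re-registered `Stmt.stub_integralDeep` in `Cruxes/BinomialCandidate/Lines/registered.lean` v7 with a STRONGER structure at
infinity: a nonzero `z` together with a second direction `z' ∉ ℂz` killed by the polar forms `B_i(z, ·)` off one index (the
"contracted line" disjunct of v4–v6 is gone, being empty by the dimension count).  The level-`7` swallower of the companion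
file satisfies the new hypothesis as well, with `z = e₀`, `z' = e₁`: `B_i(e₀) = 0` and `B_i(e₀, e₁) = 0` for ALL `i`
(`y₀` occurs only in `y₀y₂ - y₃y₀`).  Hence:

* `integralDeepV7_level_seven_false` — the level-`7` body of the v7 stub is false;
* `eight_le_of_integralDeepV7_witness` — every witness `m₀` of the v7 `Stmt.stub_integralDeep` has `8 ≤ m₀`.

Also recorded here as named lemmas (used by both versions' arguments): the kernel vectors `e₁, e₂` of the Jacobian at the
base point and the DEGENERACY of the corank-two configuration (`level7_notNondegenerate`).
No conclusion below asserts a Theses declaration positively.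
-/

namespace Summit.ValiantsHypothesis.ValiantsHypothesis.Theorems.BinomialCandidate.Negative

-- summit = sub-problem name (single-conjunct summit, D-0017 layout), so the namespace repeats it
set_option linter.dupNamespace false

open MvPolynomial

/-- `B_i(e₀, e₁) = 0` for all `i`: the second direction `z' = e₁` is killed by every polar form `B_i(e₀, ·)`
(v7 structure at infinity). [folklore] -/
theorem level7_dBe0e1 : ∀ i, ∑ j, (Pi.single 1 1 : Fin 6 → ℂ) j * MvPolynomial.eval (Pi.single 0 1 : Fin 6 → ℂ)
    (MvPolynomial.pderiv j (MvPolynomial.homogeneousComponent 2 (level7Γ i))) = 0 := by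
  intro i
  rw [Fintype.sum_eq_single (1 : Fin 6) (fun j hj => by simp [hj]), Pi.single_eq_same, one_mul, level7_B i]
  fin_cases i <;> simp [pderiv_X, Derivation.leibniz, sq]

/-- The Jacobian at the base point is the Jacobian at the origin. [folklore] -/
theorem level7_K (i : Fin 7) (j : Fin 6) : MvPolynomial.eval (fun l => (level7p l).coeff 0)
    (MvPolynomial.pderiv j (level7Γ i)) = MvPolynomial.eval (0 : Fin 6 → ℂ) (pderiv j (level7Γ i)) := by
  rw [level7_base]

/-- `e₁` is in the kernel of the Jacobian at the base point. [folklore] -/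
theorem level7_ker1 : ∀ i, ∑ j, (Pi.single 1 1 : Fin 6 → ℂ) j *
    MvPolynomial.eval (fun l => (level7p l).coeff 0) (MvPolynomial.pderiv j (level7Γ i)) = 0 := by
  intro i; simp only [level7_K]
  rw [Fintype.sum_eq_single (1 : Fin 6) (fun j hj => by simp [hj]), level7_J1 i]; simp

/-- `e₂` is in the kernel of the Jacobian at the base point. [folklore] -/
theorem level7_ker2 : ∀ i, ∑ j, (Pi.single 2 1 : Fin 6 → ℂ) j *
    MvPolynomial.eval (fun l => (level7p l).coeff 0) (MvPolynomial.pderiv j (level7Γ i)) = 0 := by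
  intro i; simp only [level7_K]
  rw [Fintype.sum_eq_single (2 : Fin 6) (fun j hj => by simp [hj]), level7_J2 i]; simp

/-- `e₁, e₂` are independent. [folklore] -/
theorem level7_kind : ∀ c₁ c₂ : ℂ, c₁ • (Pi.single 1 1 : Fin 6 → ℂ) + c₂ • (Pi.single 2 1 : Fin 6 → ℂ) = 0 →
    c₁ = 0 ∧ c₂ = 0 := by
  intro c₁ c₂ hc
  have h1 := congrFun hc 1
  have h2 := congrFun hc 2
  simp at h1 h2
  exact ⟨h1, h2⟩

/-- The corank-two configuration at the base point is DEGENERATE: the nondegeneracy clause of the stub fails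
(any `lam` in the left kernel has `lam_a 1 = 0`, and `B_i(e₁) = δ_{i1}`, while `e₁` is a kernel vector). [folklore] -/
theorem level7_notNondegenerate : ¬ (∃ (κ₁ κ₂ : Fin 6 → ℂ) (lam : Fin 3 → Fin 7 → ℂ),
    (∀ i, ∑ j, κ₁ j * MvPolynomial.eval (fun l => (level7p l).coeff 0) (MvPolynomial.pderiv j (level7Γ i)) = 0) ∧
    (∀ i, ∑ j, κ₂ j * MvPolynomial.eval (fun l => (level7p l).coeff 0) (MvPolynomial.pderiv j (level7Γ i)) = 0) ∧
    (∀ c₁ c₂ : ℂ, c₁ • κ₁ + c₂ • κ₂ = 0 → c₁ = 0 ∧ c₂ = 0) ∧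
    (∀ κ' : Fin 6 → ℂ,
      (∀ i, ∑ j, κ' j * MvPolynomial.eval (fun l => (level7p l).coeff 0) (MvPolynomial.pderiv j (level7Γ i)) = 0) →
      ∃ μ₁ μ₂ : ℂ, κ' = μ₁ • κ₁ + μ₂ • κ₂) ∧
    (∀ a : Fin 3, ∀ j : Fin 6,
      ∑ i, lam a i * MvPolynomial.eval (fun l => (level7p l).coeff 0) (MvPolynomial.pderiv j (level7Γ i)) = 0) ∧
    (∀ c : Fin 3 → ℂ, (∀ i, ∑ a, c a * lam a i = 0) → c = 0) ∧
    (∀ x₁ x₂ : ℂ, (∀ a : Fin 3, ∑ i, lam a i *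
        MvPolynomial.eval (x₁ • κ₁ + x₂ • κ₂) (MvPolynomial.homogeneousComponent 2 (level7Γ i)) = 0) →
        x₁ = 0 ∧ x₂ = 0)) := by
  rintro ⟨κ₁, κ₂, lam, -, -, -, hspan, hlam, -, hnd⟩
  obtain ⟨μ₁, μ₂, hμ⟩ := hspan (Pi.single 1 1) level7_ker1
  have hl1 : ∀ a, lam a 1 = 0 := by
    intro a
    have h3 := hlam a 3
    simp only [level7_K, level7_J3, Fin.sum_univ_seven, Matrix.cons_val_zero, Matrix.cons_val_one,
      Matrix.cons_val] at h3
    simpa using h3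
  have hzero : ∀ a : Fin 3, ∑ i, lam a i *
      MvPolynomial.eval (μ₁ • κ₁ + μ₂ • κ₂) (MvPolynomial.homogeneousComponent 2 (level7Γ i)) = 0 := by
    intro a
    simp only [← hμ, level7_Be1, Fin.sum_univ_seven, Matrix.cons_val_zero, Matrix.cons_val_one,
      Matrix.cons_val, hl1 a]
    simp
  obtain ⟨h1, h2⟩ := hnd μ₁ μ₂ hzero
  have h10 := congrFun hμ 1
  simp [h1, h2] at h10

/-! ## The level-`7` body of the v7 `Stmt.stub_integralDeep` (two pole directions at infinity) is false too -/

/-- **Level `7` of `Stmt.stub_integralDeep` (skeleton v7 text, 2026-08-17: structure at infinity = a nonzero `z` AND a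
second direction `z' ∉ ℂz`) fails**: same swallower, `z = e₀`, `z' = e₁` (`B_i(e₀) = 0` and `B_i(e₀, e₁) = 0` for all
`i`).  Body quoted verbatim with `m := 7`, `Fin (7 - 1)` written `Fin 6`. [folklore] -/
theorem integralDeepV7_level_seven_false : ¬ (∀ (a b : Fin 7 → ℕ) (Γ : Fin 7 → MvPolynomial (Fin 6) ℂ) (N : ℕ)
    (p : Fin 6 → LaurentSeries ℂ), (∀ i, (Γ i).totalDegree ≤ 2) → 0 < N →
    (∀ j, 0 ≤ (p j).order) →
    (((∃ κ₁ κ₂ : Fin 6 → ℂ,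
        (∀ i, ∑ j, κ₁ j * MvPolynomial.eval (fun l => (p l).coeff 0) (MvPolynomial.pderiv j (Γ i)) = 0) ∧
        (∀ i, ∑ j, κ₂ j * MvPolynomial.eval (fun l => (p l).coeff 0) (MvPolynomial.pderiv j (Γ i)) = 0) ∧
        ∀ c₁ c₂ : ℂ, c₁ • κ₁ + c₂ • κ₂ = 0 → c₁ = 0 ∧ c₂ = 0) ∧
      ¬ (∃ (κ₁ κ₂ : Fin 6 → ℂ) (lam : Fin 3 → Fin 7 → ℂ),
          (∀ i, ∑ j, κ₁ j * MvPolynomial.eval (fun l => (p l).coeff 0) (MvPolynomial.pderiv j (Γ i)) = 0) ∧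
          (∀ i, ∑ j, κ₂ j * MvPolynomial.eval (fun l => (p l).coeff 0) (MvPolynomial.pderiv j (Γ i)) = 0) ∧
          (∀ c₁ c₂ : ℂ, c₁ • κ₁ + c₂ • κ₂ = 0 → c₁ = 0 ∧ c₂ = 0) ∧
          (∀ κ' : Fin 6 → ℂ,
            (∀ i, ∑ j, κ' j * MvPolynomial.eval (fun l => (p l).coeff 0) (MvPolynomial.pderiv j (Γ i)) = 0) →
            ∃ μ₁ μ₂ : ℂ, κ' = μ₁ • κ₁ + μ₂ • κ₂) ∧
          (∀ a : Fin 3, ∀ j : Fin 6,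
            ∑ i, lam a i * MvPolynomial.eval (fun l => (p l).coeff 0) (MvPolynomial.pderiv j (Γ i)) = 0) ∧
          (∀ c : Fin 3 → ℂ, (∀ i, ∑ a, c a * lam a i = 0) → c = 0) ∧
          (∀ x₁ x₂ : ℂ, (∀ a : Fin 3, ∑ i, lam a i *
              MvPolynomial.eval (x₁ • κ₁ + x₂ • κ₂) (MvPolynomial.homogeneousComponent 2 (Γ i)) = 0) → x₁ = 0 ∧ x₂ = 0))) ∨
      (∃ κ : Fin 6 → ℂ, κ ≠ 0 ∧
        (∀ i, ∑ j, κ j * MvPolynomial.eval (fun l => (p l).coeff 0) (MvPolynomial.pderiv j (Γ i)) = 0) ∧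
        (∀ κ' : Fin 6 → ℂ,
          (∀ i, ∑ j, κ' j * MvPolynomial.eval (fun l => (p l).coeff 0) (MvPolynomial.pderiv j (Γ i)) = 0) →
          ∃ μ : ℂ, κ' = μ • κ) ∧
        ∃ γ : Fin 6 → Polynomial ℂ, (∀ j, (γ j).coeff 0 = (p j).coeff 0) ∧ (∀ j, (γ j).coeff 1 = κ j) ∧
          ∀ i, ∀ n ≤ Nat.log 2 7 ^ 2 / 2, (MvPolynomial.aeval γ (Γ i)).coeff n = 0)) →
    (∃ z : Fin 6 → ℂ, z ≠ 0 ∧ ∃ z' : Fin 6 → ℂ, (∀ c : ℂ, z' ≠ c • z) ∧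
      (((∀ i, MvPolynomial.eval z (MvPolynomial.homogeneousComponent 2 (Γ i)) = 0) ∧
        ∃ i₁ : Fin 7, ∀ i, i ≠ i₁ →
          ∑ j, z' j * MvPolynomial.eval z
            (MvPolynomial.pderiv j (MvPolynomial.homogeneousComponent 2 (Γ i))) = 0) ∨
      (∃ τ : Fin 7, (∀ i, i ≠ τ → MvPolynomial.eval z (MvPolynomial.homogeneousComponent 2 (Γ i)) = 0) ∧
        ∃ i₁ : Fin 7, ∀ i, i ≠ τ → i ≠ i₁ →
          ∑ j, z' j * MvPolynomial.eval z
            (MvPolynomial.pderiv j (MvPolynomial.homogeneousComponent 2 (Γ i))) = 0))) →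
    (∀ i, MvPolynomial.aeval p (Γ i) =
      HahnSeries.single ((N * a i : ℕ) : ℤ) (1 : ℂ) + HahnSeries.single ((N * b i : ℕ) : ℤ) (1 : ℂ)) →
    ∃ u v : Fin 7 → ℤ, (u, v) ≠ 0 ∧ ∑ i, (|u i| + |v i|) ≤ ((Nat.log 2 7 ^ 2 : ℕ) : ℤ) ∧
      ∑ i, (u i * (a i : ℤ) + v i * (b i : ℤ)) = 0) := by
  intro h
  refine absurd (h level7a level7b level7Γ 1 level7p level7_deg one_pos level7_ord
    (Or.inl ⟨⟨_, _, level7_ker1, level7_ker2, level7_kind⟩, level7_notNondegenerate⟩)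
    ⟨Pi.single 0 1, ?_, Pi.single 1 1, ?_, Or.inl ⟨level7_Be0, 0, fun i _ => level7_dBe0e1 i⟩⟩ level7_sol) ?_
  · exact fun h0 => by simpa using congrFun h0 0
  · exact fun c hc => by simpa using congrFun hc 1
  · -- no short relation
    rintro ⟨u, v, hne, hlen, hrel⟩
    exact hne (level7_noShortRelation u v hlen hrel)

/-- Every witness `m₀` of the v7 `Stmt.stub_integralDeep` (`Cruxes/BinomialCandidate/Lines/registered.lean` as of
2026-08-17T19:03Z; body at level `m` quoted verbatim) satisfies `8 ≤ m₀`. [folklore] -/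
theorem eight_le_of_integralDeepV7_witness (m₀ : ℕ)
    (hm : ∀ m ≥ m₀, ∀ (a b : Fin m → ℕ) (Γ : Fin m → MvPolynomial (Fin (m - 1)) ℂ) (N : ℕ)
    (p : Fin (m - 1) → LaurentSeries ℂ), (∀ i, (Γ i).totalDegree ≤ 2) → 0 < N →
    (∀ j, 0 ≤ (p j).order) →
    (((∃ κ₁ κ₂ : Fin (m - 1) → ℂ,
        (∀ i, ∑ j, κ₁ j * MvPolynomial.eval (fun l => (p l).coeff 0) (MvPolynomial.pderiv j (Γ i)) = 0) ∧
        (∀ i, ∑ j, κ₂ j * MvPolynomial.eval (fun l => (p l).coeff 0) (MvPolynomial.pderiv j (Γ i)) = 0) ∧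
        ∀ c₁ c₂ : ℂ, c₁ • κ₁ + c₂ • κ₂ = 0 → c₁ = 0 ∧ c₂ = 0) ∧
      ¬ (∃ (κ₁ κ₂ : Fin (m - 1) → ℂ) (lam : Fin 3 → Fin m → ℂ),
          (∀ i, ∑ j, κ₁ j * MvPolynomial.eval (fun l => (p l).coeff 0) (MvPolynomial.pderiv j (Γ i)) = 0) ∧
          (∀ i, ∑ j, κ₂ j * MvPolynomial.eval (fun l => (p l).coeff 0) (MvPolynomial.pderiv j (Γ i)) = 0) ∧
          (∀ c₁ c₂ : ℂ, c₁ • κ₁ + c₂ • κ₂ = 0 → c₁ = 0 ∧ c₂ = 0) ∧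
          (∀ κ' : Fin (m - 1) → ℂ,
            (∀ i, ∑ j, κ' j * MvPolynomial.eval (fun l => (p l).coeff 0) (MvPolynomial.pderiv j (Γ i)) = 0) →
            ∃ μ₁ μ₂ : ℂ, κ' = μ₁ • κ₁ + μ₂ • κ₂) ∧
          (∀ a : Fin 3, ∀ j : Fin (m - 1),
            ∑ i, lam a i * MvPolynomial.eval (fun l => (p l).coeff 0) (MvPolynomial.pderiv j (Γ i)) = 0) ∧
          (∀ c : Fin 3 → ℂ, (∀ i, ∑ a, c a * lam a i = 0) → c = 0) ∧
          (∀ x₁ x₂ : ℂ, (∀ a : Fin 3, ∑ i, lam a i *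
              MvPolynomial.eval (x₁ • κ₁ + x₂ • κ₂) (MvPolynomial.homogeneousComponent 2 (Γ i)) = 0) → x₁ = 0 ∧ x₂ = 0))) ∨
      (∃ κ : Fin (m - 1) → ℂ, κ ≠ 0 ∧
        (∀ i, ∑ j, κ j * MvPolynomial.eval (fun l => (p l).coeff 0) (MvPolynomial.pderiv j (Γ i)) = 0) ∧
        (∀ κ' : Fin (m - 1) → ℂ,
          (∀ i, ∑ j, κ' j * MvPolynomial.eval (fun l => (p l).coeff 0) (MvPolynomial.pderiv j (Γ i)) = 0) →
          ∃ μ : ℂ, κ' = μ • κ) ∧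
        ∃ γ : Fin (m - 1) → Polynomial ℂ, (∀ j, (γ j).coeff 0 = (p j).coeff 0) ∧ (∀ j, (γ j).coeff 1 = κ j) ∧
          ∀ i, ∀ n ≤ Nat.log 2 m ^ 2 / 2, (MvPolynomial.aeval γ (Γ i)).coeff n = 0)) →
    (∃ z : Fin (m - 1) → ℂ, z ≠ 0 ∧ ∃ z' : Fin (m - 1) → ℂ, (∀ c : ℂ, z' ≠ c • z) ∧
      (((∀ i, MvPolynomial.eval z (MvPolynomial.homogeneousComponent 2 (Γ i)) = 0) ∧
        ∃ i₁ : Fin m, ∀ i, i ≠ i₁ →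
          ∑ j, z' j * MvPolynomial.eval z
            (MvPolynomial.pderiv j (MvPolynomial.homogeneousComponent 2 (Γ i))) = 0) ∨
      (∃ τ : Fin m, (∀ i, i ≠ τ → MvPolynomial.eval z (MvPolynomial.homogeneousComponent 2 (Γ i)) = 0) ∧
        ∃ i₁ : Fin m, ∀ i, i ≠ τ → i ≠ i₁ →
          ∑ j, z' j * MvPolynomial.eval z
            (MvPolynomial.pderiv j (MvPolynomial.homogeneousComponent 2 (Γ i))) = 0))) →
    (∀ i, MvPolynomial.aeval p (Γ i) =
      HahnSeries.single ((N * a i : ℕ) : ℤ) (1 : ℂ) + HahnSeries.single ((N * b i : ℕ) : ℤ) (1 : ℂ)) →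
    ∃ u v : Fin m → ℤ, (u, v) ≠ 0 ∧ ∑ i, (|u i| + |v i|) ≤ ((Nat.log 2 m ^ 2 : ℕ) : ℤ) ∧
      ∑ i, (u i * (a i : ℤ) + v i * (b i : ℤ)) = 0) :
    8 ≤ m₀ := by
  by_contra hlt
  exact integralDeepV7_level_seven_false (hm 7 (by omega))

end Summit.ValiantsHypothesis.ValiantsHypothesis.Theorems.BinomialCandidate.Negative
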